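import Literature.Analysis.FunctionSpaces.LittlewoodPaleyInhomogeneousProofs
import Literature.Analysis.UnboundedOperators.HeatIteratedDerivBounds
import Literature.Analysis.UnboundedOperators.HeatSemigroupLpProofs
import Literature.Analysis.UnboundedOperators.HeatKernelGaussianData
import HarnessLib

/-!
# Smooth representatives of the dyadic blocks of an `L^∞`-type distribution, via the heat flow

Sibling proof file of `Literature/Analysis/FunctionSpaces/LittlewoodPaley.lean` on the discharge
path of the named fact `Literature.Analysis.FunctionSpaces.memBesov_top_top_iff_memContDiffHolder`
(Triebel 1983, Thm. 2.5.7: `B^{k+r}_{∞,∞} = C^{k,r}_b`). Everything here is **proved**. For the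
converse inclusion `B^{k+r}_{∞,∞} ⊂ C^{k,r}_b` one needs, for a tempered distribution `u` whose block
`Δ̇_j u` (resp. low-frequency part `Ṡ₀ u`) is an `L^∞` function, a **smooth function representing the
block together with Bernstein's bounds on all its derivatives**,
`‖Dᵐ(Δ̇_j u)‖_∞ ≤ A_m 2^{jm} ‖Δ̇_j u‖_∞` (Bahouri–Chemin–Danchin, Lemma 2.1; Triebel 1983,
(1.3.2/5) with Rem. 1.4.1/4, the Nikol'skij inequality; Grafakos, *Modern Fourier Analysis*,
proof of Thm. 1.4.9: `‖∂^α(η_{2^{-j}} ⋆ η_{2^{-j}} ⋆ Δ_j^Θ f)‖_∞ ≤ 2^{j|α|} ‖∂^α(η ⋆ η)‖_{L¹} ‖Δ_j^Θ f‖_∞`).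

Instead of differentiating convolution integrals with Schwartz kernels on the kernel side, we
represent the blocks through the **heat flow**, whose smoothing theory on `L^∞` data is in the tree
(`Literature.Analysis.UnboundedOperators.exists_norm_iteratedFDeriv_heatExtension_le`:
`‖Dᵐ(e^{tΔ} w)‖_∞ ≤ A_m t^{-m/2} ‖w‖_∞`; `MeasureTheory.Lp.heatSemigroup_toTemperedDistribution_Lp_holds`:
the Fourier-multiplier heat semigroup on `𝓢'` is the Gauss–Weierstrass integral on `L^p`):

* `Δ̇_j u = e^{t_jΔ} (Θ(2^{-j}D) Δ̇_j u)` with `t_j = 4^{-j}` and the smooth compactly supported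
  symbol `Θ(η) = e^{(2π)²‖η‖²} ψ(η)` (`ψ` the reproducing symbol of the blocks,
  `Literature.Analysis.FunctionSpaces.bernsteinSymbol`): indeed
  `e^{-(2π)² t_j ‖ξ‖²} Θ(2^{-j}ξ) = ψ(2^{-j}ξ)` and `ψ(2^{-j}D) Δ̇_j = Δ̇_j`
  (`Literature.Analysis.FunctionSpaces.lpBlock_eq_heatSemigroup_fourierMultiplierCLM`); the block
  multiplier lemma (`Literature.Analysis.FunctionSpaces.exists_eLpNormDistrib_fourierMultiplierCLM_lpBlock_le`,
  BCD Lemma 2.2) bounds `‖Θ(2^{-j}D) Δ̇_j u‖_∞ ≤ C ‖Δ̇_j u‖_∞` uniformly in `j`, and the heat flow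
  for time `t_j` of this `L^∞` function is smooth with `m`-th derivatives
  `≤ A_m t_j^{-m/2} C ‖Δ̇_j u‖_∞ = A_m 2^{jm} C ‖Δ̇_j u‖_∞`
  (`Literature.Analysis.FunctionSpaces.exists_smooth_rep_lpBlock`);
* `Ṡ₀ u = e^{Δ} (Θ₀(D) Ṡ₀ u)` with `Θ₀(ξ) = e^{(2π)²‖ξ‖²} χ(ξ/2)` (`e^{-(2π)²‖ξ‖²} Θ₀ = χ(·/2)` and
  `Ṡ₁ Ṡ₀ = Ṡ₀`), `Θ₀(D)` bounded on `L^∞` by Young's inequality (Schwartz symbol), whence a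
  smooth representative of `Ṡ₀ u` with all derivatives bounded
  (`Literature.Analysis.FunctionSpaces.exists_smooth_rep_lowFreqCutoff_zero`).

Also: every `L^∞` class has a strongly measurable representative bounded *everywhere* by its norm
(`Literature.Analysis.FunctionSpaces.exists_stronglyMeasurable_norm_le_ae_eq`), and the all-order
derivative bounds of the heat extension of an `L^∞` class
(`Literature.Analysis.FunctionSpaces.exists_norm_iteratedFDeriv_heatExtension_coe_le`).

## References

* H. Triebel, *Theory of Function Spaces*, Birkhäuser (1983), (1.3.2/5) and Remark 1.4.1/4
  (Nikol'skij's inequality `‖D^α φ‖_q ≤ c b^{|α|+n(1/p-1/q)} ‖φ‖_p` for `supp 𝓕φ ⊂ B_b`), §2.5.7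
  (held; PDF pp. 131, 136, 218–220). [cite: Triebel1983, (1.3.2/5) and Thm. 2.5.7]
* H. Bahouri, J.-Y. Chemin, R. Danchin, *Fourier Analysis and Nonlinear Partial Differential
  Equations*, Springer (2011), Lemmas 2.1–2.2. [cite: BahouriCheminDanchin2011, Lemma 2.1]
* L. Grafakos, *Modern Fourier Analysis*, 3rd ed., GTM 250 (2014), proof of Thm. 1.4.9
  (held as `book:grafakos2009-modern-fourier-analysis`, PDF pp. 98–100).
* M.-H. Giga, Y. Giga, J. Saal, *Nonlinear Partial Differential Equations*, Birkhäuser (2010),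
  §1.1.3 (derivative estimates for the heat semigroup). [cite: GigaGigaSaal2010, §1.1.3]
-/

noncomputable section

open MeasureTheory FourierTransform SchwartzMap Real Filter Topology Function TemperedDistribution
open scoped SchwartzMap ENNReal NNReal FourierTransform RealInnerProductSpace Convolution

namespace Literature.Analysis.FunctionSpaces

/-! ## Bounded representatives of `L^∞` classes and the heat flow of `L^∞` data -/

section BoundedRep

variable {α : Type*} [MeasurableSpace α] {μ : Measure α} {F : Type*} [NormedAddCommGroup F]

/-- Every `L^∞` class has a strongly measurable representative bounded **everywhere** by the `L^∞`
norm: modify a strongly measurable version on the null set where it exceeds `‖v‖_∞`. [folklore] -/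
theorem exists_stronglyMeasurable_norm_le_ae_eq (v : Lp F ∞ μ) :
    ∃ w : α → F, StronglyMeasurable w ∧ (∀ z, ‖w z‖ ≤ ‖v‖) ∧ w =ᵐ[μ] (v : α → F) := by
  have hv : AEStronglyMeasurable (v : α → F) μ := Lp.aestronglyMeasurable v
  set v' : α → F := hv.mk (v : α → F) with hv'
  have hsm : StronglyMeasurable v' := hv.stronglyMeasurable_mk
  have hae : (v : α → F) =ᵐ[μ] v' := hv.ae_eq_mk
  set S : Set α := {z | ‖v' z‖ ≤ ‖v‖} with hS
  have hSm : MeasurableSet S := measurableSet_le hsm.norm.measurable measurable_const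
  refine ⟨S.indicator v', hsm.indicator hSm, fun z => ?_, ?_⟩
  · by_cases hz : z ∈ S
    · rw [Set.indicator_of_mem hz]; exact hz
    · rw [Set.indicator_of_notMem hz, norm_zero]; exact norm_nonneg _
  · -- a.e. `‖v z‖ ≤ ‖v‖`, so a.e. `z ∈ S`
    have hbound : ∀ᵐ z ∂μ, ‖(v : α → F) z‖ ≤ ‖v‖ := by
      filter_upwards [ae_le_eLpNormEssSup (f := (v : α → F)) (μ := μ)] with z hz
      rw [← eLpNorm_exponent_top, ← Lp.enorm_def] at hz
      rw [← ENNReal.ofReal_le_ofReal_iff (norm_nonneg _), ofReal_norm, ofReal_norm]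
      exact hz
    filter_upwards [hbound, hae] with z hz hz'
    have hzS : z ∈ S := by
      change ‖v' z‖ ≤ ‖v‖
      rwa [← hz']
    rw [Set.indicator_of_mem hzS, hz']

end BoundedRep

section HeatLinfty

variable {E : Type*} [NormedAddCommGroup E] [InnerProductSpace ℝ E] [FiniteDimensional ℝ E]
  [MeasurableSpace E] [BorelSpace E] {F : Type*} [NormedAddCommGroup F] [NormedSpace ℝ F]
  [CompleteSpace F]

/-- **All-order derivative bounds for the heat flow of an `L^∞` class** (Giga–Giga–Saal 2010,
§1.1.3): for every `m` there is `A ≥ 0` with `‖Dᵐ(e^{tΔ} v)(x)‖ ≤ A t^{-m/2} ‖v‖_{L^∞}` for all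
`t > 0`, `v ∈ L^∞(E; F)`, `x` — the tree's `exists_norm_iteratedFDeriv_heatExtension_le` applied
to an everywhere-bounded representative (the caloric extension only depends on the a.e. class,
`heatExtension_congr_ae'`). [cite: GigaGigaSaal2010, §1.1.3] -/
theorem exists_norm_iteratedFDeriv_heatExtension_coe_le (m : ℕ) :
    ∃ A : ℝ, 0 ≤ A ∧ ∀ ⦃t : ℝ⦄, 0 < t → ∀ (v : Lp F ∞ (volume : Measure E)) (x : E),
      ‖iteratedFDeriv ℝ m (UnboundedOperators.heatExtension (v : E → F) t) x‖ ≤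
        A * t ^ (-(m : ℝ) / 2) * ‖v‖ := by
  obtain ⟨A, hA0, hA⟩ := UnboundedOperators.exists_norm_iteratedFDeriv_heatExtension_le (E := E) (F := F) m
  refine ⟨A, hA0, fun t ht v x => ?_⟩
  obtain ⟨w, hwm, hwb, hwae⟩ := exists_stronglyMeasurable_norm_le_ae_eq v
  rw [← UnboundedOperators.heatExtension_congr_ae' hwae t]
  exact hA ht hwm.aestronglyMeasurable hwb x

end HeatLinfty

/-! ## The heat-corrected symbols -/

section Symbols

variable {E : Type*} [NormedAddCommGroup E] [InnerProductSpace ℝ E]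

/-- The Gaussian weight `ξ ↦ e^{(2π)² ‖ξ‖²}` (complex-valued) is smooth. [folklore] -/
theorem contDiff_ofReal_exp_sq_norm :
    ContDiff ℝ (⊤ : ℕ∞) (fun ξ : E => (Real.exp ((2 * π) ^ 2 * ‖ξ‖ ^ 2) : ℂ)) :=
  Complex.ofRealCLM.contDiff.comp (Real.contDiff_exp.comp (contDiff_const.mul (contDiff_norm_sq ℝ)))

/-- The heat symbol cancels the Gaussian weight at the matching scale:
`e^{(2π)² ‖c ξ‖²} e^{-(2π)² c² ‖ξ‖²} = 1`. [folklore] -/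
theorem ofReal_exp_sq_norm_smul_mul_heatSymbol (c : ℝ) (ξ : E) :
    (Real.exp ((2 * π) ^ 2 * ‖c • ξ‖ ^ 2) : ℂ) *
      (UnboundedOperators.heatSymbol (c ^ 2) ξ : ℂ) = 1 := by
  rw [UnboundedOperators.heatSymbol, ← Complex.ofReal_mul, ← Real.exp_add, norm_smul, Real.norm_eq_abs]
  have h : (2 * π) ^ 2 * (|c| * ‖ξ‖) ^ 2 + -(2 * π) ^ 2 * c ^ 2 * ‖ξ‖ ^ 2 = 0 := by
    rw [mul_pow |c| ‖ξ‖ 2, sq_abs]; ring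
  rw [h, Real.exp_zero, Complex.ofReal_one]

/-- `χ χ(·/2) = χ`: the symbol of `Ṡ₁` is `1` on the support of that of `Ṡ₀`
(`supp χ ⊆ {‖ξ‖ < 2}`, where `χ(ξ/2) = 1`). (Private twin of the lemma of the same name in
`LittlewoodPaleyHolderProofs.lean`, which is not imported here.) [folklore] -/
private theorem lowFreqSymbol_zero_mul_lowFreqSymbol_one' :
    (lowFreqSymbol 0 : E → ℂ) * lowFreqSymbol 1 = lowFreqSymbol 0 := by
  funext ξ
  simp only [Pi.mul_apply]
  rcases le_or_gt ‖ξ‖ 2 with h | h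
  · rw [lowFreqSymbol_eq_one_of_norm_le (j := 1) (by simpa using h), mul_one]
  · have h0 : lowFreqSymbol 0 ξ = 0 := by
      simp only [lowFreqSymbol, neg_zero, zpow_zero, one_smul]
      rw [dyadicCutoff_apply_of_two_le_norm h.le, Complex.ofReal_zero]
    rw [h0, zero_mul]

variable [FiniteDimensional ℝ E]

/-- The block symbol `Θ = e^{(2π)²‖·‖²} ψ` is smooth with compact support. [folklore] -/
theorem contDiff_hasCompactSupport_blockHeatSymbol :
    ContDiff ℝ (⊤ : ℕ∞) (fun ξ : E => (Real.exp ((2 * π) ^ 2 * ‖ξ‖ ^ 2) : ℂ) * bernsteinSymbol ξ) ∧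
      HasCompactSupport (fun ξ : E => (Real.exp ((2 * π) ^ 2 * ‖ξ‖ ^ 2) : ℂ) * bernsteinSymbol ξ) :=
  ⟨contDiff_ofReal_exp_sq_norm.mul contDiff_bernsteinSymbol, hasCompactSupport_bernsteinSymbol.mul_left⟩

/-- The low-frequency symbol `Θ₀ = e^{(2π)²‖·‖²} χ(·/2)` is smooth with compact support. [folklore] -/
theorem contDiff_hasCompactSupport_lowHeatSymbol :
    ContDiff ℝ (⊤ : ℕ∞) (fun ξ : E => (Real.exp ((2 * π) ^ 2 * ‖ξ‖ ^ 2) : ℂ) * lowFreqSymbol 1 ξ) ∧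
      HasCompactSupport (fun ξ : E => (Real.exp ((2 * π) ^ 2 * ‖ξ‖ ^ 2) : ℂ) * lowFreqSymbol 1 ξ) :=
  ⟨contDiff_ofReal_exp_sq_norm.mul (contDiff_lowFreqSymbol 1), (hasCompactSupport_lowFreqSymbol 1).mul_left⟩

end Symbols

/-! ## Smooth representatives of the blocks -/

section Representatives

variable {E : Type*} [NormedAddCommGroup E] [InnerProductSpace ℝ E] [FiniteDimensional ℝ E]
  [MeasurableSpace E] [BorelSpace E] {F : Type*} [NormedAddCommGroup F] [NormedSpace ℂ F]

/-- **The heat representation of the blocks**: `Δ̇_j u = e^{t_jΔ} (Θ(2^{-j}D) Δ̇_j u)` on `𝓢'(E, F)`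
with `t_j = (2^{-j})²` and `Θ = e^{(2π)²‖·‖²} ψ` — the symbols multiply to `ψ(2^{-j} ·)`, which
reproduces the block (`lpBlock_eq_fourierMultiplierCLM_bernsteinSymbol_rescaled`). [folklore] -/
theorem lpBlock_eq_heatSemigroup_fourierMultiplierCLM (j : ℤ) (u : 𝓢'(E, F)) :
    lpBlock j u = TemperedDistribution.heatSemigroup (((2 : ℝ) ^ (-j)) ^ 2)
      (fourierMultiplierCLM F
        (fun ξ : E => (Real.exp ((2 * π) ^ 2 * ‖((2 : ℝ) ^ (-j)) • ξ‖ ^ 2) : ℂ) *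
          bernsteinSymbol (((2 : ℝ) ^ (-j)) • ξ)) (lpBlock j u)) := by
  set c : ℝ := (2 : ℝ) ^ (-j) with hc
  have hΘ := contDiff_hasCompactSupport_blockHeatSymbol (E := E)
  have hΘt : (fun ξ : E => (Real.exp ((2 * π) ^ 2 * ‖ξ‖ ^ 2) : ℂ) * bernsteinSymbol ξ).HasTemperateGrowth :=
    hΘ.2.hasTemperateGrowth hΘ.1
  have hg : (fun ξ : E => (Real.exp ((2 * π) ^ 2 * ‖c • ξ‖ ^ 2) : ℂ) * bernsteinSymbol (c • ξ)).HasTemperateGrowth :=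
    hΘt.comp (c • ContinuousLinearMap.id ℝ E).hasTemperateGrowth
  have hheat : (fun ξ : E => (UnboundedOperators.heatSymbol (c ^ 2) ξ : ℂ)).HasTemperateGrowth :=
    UnboundedOperators.heatSymbol_hasTemperateGrowth_complex
      UnboundedOperators.heatSymbol_hasTemperateGrowth_holds (sq_nonneg c)
  rw [TemperedDistribution.heatSemigroup_eq_fourierMultiplierCLM,
    TemperedDistribution.fourierMultiplierCLM_fourierMultiplierCLM_apply hg hheat]
  have hsymb : ((fun ξ : E => (Real.exp ((2 * π) ^ 2 * ‖c • ξ‖ ^ 2) : ℂ) * bernsteinSymbol (c • ξ)) *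
      fun ξ : E => (UnboundedOperators.heatSymbol (c ^ 2) ξ : ℂ)) =
      fun ξ : E => bernsteinSymbol (c • ξ) := by
    funext ξ
    simp only [Pi.mul_apply]
    rw [mul_right_comm, ofReal_exp_sq_norm_smul_mul_heatSymbol, one_mul]
  rw [hsymb, hc]
  exact lpBlock_eq_fourierMultiplierCLM_bernsteinSymbol_rescaled j u

/-- **The heat representation of the low frequencies**: `Ṡ₀ u = e^{Δ} (Θ₀(D) Ṡ₀ u)` on `𝓢'(E, F)`
with `Θ₀ = e^{(2π)²‖·‖²} χ(·/2)` — the symbols multiply to `χ(·/2)`, and `Ṡ₁ Ṡ₀ = Ṡ₀`. [folklore] -/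
theorem lowFreqCutoff_zero_eq_heatSemigroup_fourierMultiplierCLM (u : 𝓢'(E, F)) :
    lowFreqCutoff 0 u = TemperedDistribution.heatSemigroup 1
      (fourierMultiplierCLM F
        (fun ξ : E => (Real.exp ((2 * π) ^ 2 * ‖ξ‖ ^ 2) : ℂ) * lowFreqSymbol 1 ξ) (lowFreqCutoff 0 u)) := by
  have hΘ := contDiff_hasCompactSupport_lowHeatSymbol (E := E)
  have hg : (fun ξ : E => (Real.exp ((2 * π) ^ 2 * ‖ξ‖ ^ 2) : ℂ) * lowFreqSymbol 1 ξ).HasTemperateGrowth :=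
    hΘ.2.hasTemperateGrowth hΘ.1
  have hheat : (fun ξ : E => (UnboundedOperators.heatSymbol 1 ξ : ℂ)).HasTemperateGrowth :=
    UnboundedOperators.heatSymbol_hasTemperateGrowth_complex
      UnboundedOperators.heatSymbol_hasTemperateGrowth_holds zero_le_one
  rw [TemperedDistribution.heatSemigroup_eq_fourierMultiplierCLM,
    TemperedDistribution.fourierMultiplierCLM_fourierMultiplierCLM_apply hg hheat]
  have hsymb : ((fun ξ : E => (Real.exp ((2 * π) ^ 2 * ‖ξ‖ ^ 2) : ℂ) * lowFreqSymbol 1 ξ) *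
      fun ξ : E => (UnboundedOperators.heatSymbol 1 ξ : ℂ)) = lowFreqSymbol 1 := by
    funext ξ
    simp only [Pi.mul_apply]
    have h := ofReal_exp_sq_norm_smul_mul_heatSymbol (1 : ℝ) ξ
    rw [one_smul, one_pow] at h
    rw [mul_right_comm, h, one_mul]
  rw [hsymb, lowFreqCutoff_apply,
    TemperedDistribution.fourierMultiplierCLM_fourierMultiplierCLM_apply (hasTemperateGrowth_lowFreqSymbol 0)
      (hasTemperateGrowth_lowFreqSymbol 1), lowFreqSymbol_zero_mul_lowFreqSymbol_one']

variable [CompleteSpace F]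

/-- `((2^{-j})²)^{-m/2} = 2^{jm}`: the heat time `t_j = 4^{-j}` converts the smoothing rate
`t^{-m/2}` into Bernstein's factor `2^{jm}`. [folklore] -/
theorem two_zpow_neg_sq_rpow (j : ℤ) (m : ℕ) :
    ((((2 : ℝ) ^ (-j)) ^ 2) ^ (-(m : ℝ) / 2) : ℝ) = (2 : ℝ) ^ ((j : ℝ) * m) := by
  have h2 : (0 : ℝ) < (2 : ℝ) ^ (-j) := zpow_pos two_pos _
  rw [← Real.rpow_natCast _ 2, ← Real.rpow_mul h2.le, ← Real.rpow_intCast, ← Real.rpow_mul zero_le_two]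
  congr 1
  push_cast
  ring

/-- **Smooth representatives of the dyadic blocks, with Bernstein's bounds** (BCD Lemma 2.1;
Triebel 1983, (1.3.2/5); Grafakos, proof of Thm. 1.4.9): there are constants `A_m ≥ 0` (`m ∈ ℕ`)
and `C < ∞` such that for every `j ∈ ℤ` and every `u ∈ 𝓢'(E, F)` whose block `Δ̇_j u` is an `L^∞`
function, `Δ̇_j u` is (the distribution of) a `C^∞` function `g` all of whose derivatives are
bounded, `‖Dᵐ g(x)‖ ≤ A_m 2^{jm} · (C ‖Δ̇_j u‖_{L^∞})`. Construction: `g = e^{t_jΔ} w` with `t_j = 4^{-j}`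
and `w = Θ(2^{-j}D) Δ̇_j u ∈ L^∞`, `‖w‖_∞ ≤ C ‖Δ̇_j u‖_∞`
(`exists_eLpNormDistrib_fourierMultiplierCLM_lpBlock_le`), followed by the heat smoothing bounds
`‖Dᵐ e^{tΔ} w‖_∞ ≤ A_m t^{-m/2} ‖w‖_∞`. [cite: Triebel1983, (1.3.2/5) and Rem. 1.4.1/4] -/
theorem exists_smooth_rep_lpBlock :
    ∃ (A : ℕ → ℝ) (C : ℝ≥0∞), (∀ m, 0 ≤ A m) ∧ C < ⊤ ∧
      ∀ (j : ℤ) (u : 𝓢'(E, F)), eLpNormDistrib ∞ (lpBlock j u) < ⊤ →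
        ∃ g : E → F, ContDiff ℝ (⊤ : ℕ∞) g ∧
          (∀ (m : ℕ) (x : E), ‖iteratedFDeriv ℝ m g x‖ ≤
            A m * (2 : ℝ) ^ ((j : ℝ) * m) * (C * eLpNormDistrib ∞ (lpBlock j u)).toReal) ∧
          ∃ hg : MemLp g ∞ (volume : Measure E),
            ((hg.toLp g : Lp F ∞ (volume : Measure E)) : 𝓢'(E, F)) = lpBlock j u := by
  -- the constants
  choose A hA0 hA using fun m => exists_norm_iteratedFDeriv_heatExtension_coe_le (E := E) (F := F) m
  obtain ⟨n, C₁, hC₁⟩ := exists_eLpNormDistrib_fourierMultiplierCLM_lpBlock_le (E := E) (F := F) ∞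
  have hΘ := contDiff_hasCompactSupport_blockHeatSymbol (E := E)
  set Θ : 𝓢(E, ℂ) := hΘ.2.toSchwartzMap hΘ.1 with hΘdef
  have hΘcoe : (Θ : E → ℂ) = fun ξ : E => (Real.exp ((2 * π) ^ 2 * ‖ξ‖ ^ 2) : ℂ) * bernsteinSymbol ξ := rfl
  set B : ℝ := (Finset.Iic ((0 : ℕ), n)).sup (schwartzSeminormFamily ℂ E ℂ) Θ with hB
  have hB0 : 0 ≤ B := apply_nonneg _ _
  have hBder : ∀ N ≤ n, ∀ x : E, ‖iteratedFDeriv ℝ N (Θ : E → ℂ) x‖ ≤ B := by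
    intro N hN x
    have h := le_seminorm ℂ 0 N Θ x
    rw [pow_zero, one_mul] at h
    exact h.trans (Seminorm.le_def.1 (Finset.le_sup (f := schwartzSeminormFamily ℂ E ℂ)
      (Finset.mem_Iic.2 (Prod.mk_le_mk.2 ⟨le_rfl, hN⟩))) _)
  refine ⟨A, C₁ * ENNReal.ofReal B, hA0, ENNReal.mul_lt_top ENNReal.coe_lt_top ENNReal.ofReal_lt_top,
    fun j u hu => ?_⟩
  -- the rescaled symbol `Θ_j = Θ(2^{-j} ·)`
  set c : ℝ := (2 : ℝ) ^ (-j) with hc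
  have hc0 : 0 < c := zpow_pos two_pos _
  set Θj : E → ℂ := fun ξ => (Real.exp ((2 * π) ^ 2 * ‖c • ξ‖ ^ 2) : ℂ) * bernsteinSymbol (c • ξ)
    with hΘj
  have hΘjt : Θj.HasTemperateGrowth :=
    (show Θj = (Θ : E → ℂ) ∘ (c • ContinuousLinearMap.id ℝ E) from rfl) ▸
      Θ.hasTemperateGrowth.comp (c • ContinuousLinearMap.id ℝ E).hasTemperateGrowth
  have hresc : (fun ξ : E => Θj (((2 : ℝ) ^ j) • ξ)) = (Θ : E → ℂ) := by
    funext ξ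
    simp only [hΘj, hΘcoe, smul_smul, hc, ← zpow_add₀ (two_ne_zero' ℝ), neg_add_cancel, zpow_zero,
      one_smul]
  -- `w = Θ_j(D) Δ̇_j u ∈ L^∞` with `‖w‖ ≤ C ‖Δ̇_j u‖`
  have hwbound : eLpNormDistrib ∞ (fourierMultiplierCLM F Θj (lpBlock j u)) ≤
      C₁ * ENNReal.ofReal B * eLpNormDistrib ∞ (lpBlock j u) :=
    hC₁ Θj hΘjt j B hB0 (fun N hN x _ => by rw [hresc]; exact hBder N hN x) u
  have hwfin : eLpNormDistrib ∞ (fourierMultiplierCLM F Θj (lpBlock j u)) < ⊤ :=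
    hwbound.trans_lt (ENNReal.mul_lt_top (ENNReal.mul_lt_top ENNReal.coe_lt_top ENNReal.ofReal_lt_top) hu)
  obtain ⟨w, hw⟩ := exists_coe_eq_of_eLpNormDistrib_lt_top hwfin
  have hwnorm : ‖w‖ ≤ (C₁ * ENNReal.ofReal B * eLpNormDistrib ∞ (lpBlock j u)).toReal := by
    rw [Lp.norm_def, ← Lp.enorm_def, ← eLpNormDistrib_coe, hw]
    exact ENNReal.toReal_mono (ENNReal.mul_lt_top (ENNReal.mul_lt_top ENNReal.coe_lt_top
      ENNReal.ofReal_lt_top) hu).ne hwbound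
  -- the heat extension
  set t : ℝ := c ^ 2 with ht
  have ht0 : 0 < t := pow_pos hc0 2
  have hmem : MemLp (UnboundedOperators.heatExtension (w : E → F) t) ∞ (volume : Measure E) :=
    UnboundedOperators.memLp_heatExtension_holds (Lp.memLp w) le_top ht0
  refine ⟨UnboundedOperators.heatExtension (w : E → F) t,
    UnboundedOperators.contDiff_heatExtension_holds (Lp.memLp w) le_top ht0, fun m x => ?_, hmem, ?_⟩
  · calc ‖iteratedFDeriv ℝ m (UnboundedOperators.heatExtension (w : E → F) t) x‖
        ≤ A m * t ^ (-(m : ℝ) / 2) * ‖w‖ := hA m ht0 w x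
      _ ≤ A m * t ^ (-(m : ℝ) / 2) * (C₁ * ENNReal.ofReal B * eLpNormDistrib ∞ (lpBlock j u)).toReal := by
          gcongr
          exact mul_nonneg (hA0 m) (Real.rpow_nonneg ht0.le _)
      _ = A m * (2 : ℝ) ^ ((j : ℝ) * m) * (C₁ * ENNReal.ofReal B * eLpNormDistrib ∞ (lpBlock j u)).toReal := by
          rw [ht, hc, two_zpow_neg_sq_rpow]
  · rw [lpBlock_eq_heatSemigroup_fourierMultiplierCLM j u, ← hc, ← hw,
      Lp.heatSemigroup_toTemperedDistribution_Lp_holds UnboundedOperators.memLp_heatExtension_holds w ht0]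

/-- **A smooth representative of the low frequencies `Ṡ₀ u`, with all derivatives bounded**: if
`Ṡ₀ u ∈ L^∞` then `Ṡ₀ u` is (the distribution of) a `C^∞` function all of whose derivatives are
bounded — `Ṡ₀ u = e^{Δ}(Θ₀(D) Ṡ₀ u)` with `Θ₀(D)` bounded on `L^∞` (Schwartz symbol, Young's
inequality `eLpNormDistrib_fourierMultiplierCLM_le`) and the heat smoothing bounds at time `1`
(Triebel 1983, 2.5.7 Step 1 of the Proposition: "every `F⁻¹φ_k F f` is bounded and uniformly
continuous", via (1.4.1/3)). [cite: Triebel1983, Prop. 2.5.7/(2) Step 1] -/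
theorem exists_smooth_rep_lowFreqCutoff_zero (u : 𝓢'(E, F))
    (hu : eLpNormDistrib ∞ (lowFreqCutoff 0 u) < ⊤) :
    ∃ g : E → F, ContDiff ℝ (⊤ : ℕ∞) g ∧ (∀ m : ℕ, ∃ B : ℝ, ∀ x : E, ‖iteratedFDeriv ℝ m g x‖ ≤ B) ∧
      ∃ hg : MemLp g ∞ (volume : Measure E),
        ((hg.toLp g : Lp F ∞ (volume : Measure E)) : 𝓢'(E, F)) = lowFreqCutoff 0 u := by
  have hΘ := contDiff_hasCompactSupport_lowHeatSymbol (E := E)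
  set Θ : 𝓢(E, ℂ) := hΘ.2.toSchwartzMap hΘ.1 with hΘdef
  have hΘcoe : (Θ : E → ℂ) = fun ξ : E => (Real.exp ((2 * π) ^ 2 * ‖ξ‖ ^ 2) : ℂ) * lowFreqSymbol 1 ξ := rfl
  -- `w = Θ₀(D) Ṡ₀ u ∈ L^∞`
  have hwfin : eLpNormDistrib ∞ (fourierMultiplierCLM F (Θ : E → ℂ) (lowFreqCutoff 0 u)) < ⊤ :=
    (eLpNormDistrib_fourierMultiplierCLM_le Θ (lowFreqCutoff 0 u)).trans_lt
      (ENNReal.mul_lt_top (max_lt ((𝓕⁻ Θ).eLpNorm_lt_top 1 volume) ENNReal.one_lt_top) hu)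
  obtain ⟨w, hw⟩ := exists_coe_eq_of_eLpNormDistrib_lt_top hwfin
  have hmem : MemLp (UnboundedOperators.heatExtension (w : E → F) 1) ∞ (volume : Measure E) :=
    UnboundedOperators.memLp_heatExtension_holds (Lp.memLp w) le_top one_pos
  refine ⟨UnboundedOperators.heatExtension (w : E → F) 1,
    UnboundedOperators.contDiff_heatExtension_holds (Lp.memLp w) le_top one_pos, fun m => ?_, hmem, ?_⟩
  · obtain ⟨A, -, hA⟩ := exists_norm_iteratedFDeriv_heatExtension_coe_le (E := E) (F := F) m
    exact ⟨A * (1 : ℝ) ^ (-(m : ℝ) / 2) * ‖w‖, fun x => hA one_pos w x⟩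
  · rw [lowFreqCutoff_zero_eq_heatSemigroup_fourierMultiplierCLM u, ← hΘcoe, ← hw,
      Lp.heatSemigroup_toTemperedDistribution_Lp_holds UnboundedOperators.memLp_heatExtension_holds w one_pos]

end Representatives

end Literature.Analysis.FunctionSpaces
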